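import Summits.Schanuel.Schanuel.Theorems.RootDecomp1KIntegrality04

/-!
# RootDecomp1KThueMahler — lens 1, generation 56, NODE 16 «THUE–MAHLER ON THE LINE» (RULE K-R46 payable clause; CLAIM L2656, PRICE L2660) — part 1 (RootDecomp1KThueMahler01): §1 coprimality and the resultant bound, §2 the odd part, §3 the archimedean floor, §4 bounded dyadic points

(lens-1 g56 NODE 16 HOME kernel K = HOME/decomp-schanuel-lens-1/g56/ThueMahler.lean d10a59d7…, 957 l, 92 thm + 7 def, imports tree …RootDecomp1KIntegrality04 ONLY (no Literature import, no fact def, no private / set_option); Probe / Ctrl0 / Ctrl + NODE-g56.md + presearch_g56.txt + SHA256SUMS; CLAIM L2656, census LIVENESS-v5 node-16 rows L2657 (of record L2661 (A)), crit EX-ANTE PRICE L2660 (ONE THEOREM ×1 under K-R46's payable clause «an infinite class of AMENDED-FRONTIER pairs made unconditional by an input outside the toolkit of record» iff CHECKLIST K-g56; hand check of the Thue–Mahler mechanism SOUND), crit RULING L2661 (B) (L17P ERRATUM of record: `L17P = normShapeCurve (−(Y+3)) (Y²−17) 1 1` is LEVEL-FINITE hyp-free by node 10), NODE L2664, critic VERDICT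 L2665: CLEARED — THEOREM ×1 under K-R46's payable clause (EX-ANTE PRICE L2660), CHECKLIST K-g56 (1)–(10) MET; erratum §9 = ×0 bookkeeping as RULED L2661 (B); RULE K-R47 FIXED (toolkit of record ∪ {multi-form elimination at the odd places (`exists_resultant_bound`, two charts), archimedean floor (`exists_arch_floor`), product-formula transfer (`abs_mul_norm_le_of_odd_part`, `hform_eq_prod`), height-fed Ridout/Liouville closing}; FRONTIER re-amended by «NOT LEVEL-FINITE by the {2, ∞} Thue–Mahler reduction (XLinTM)»; open territory of record at m₀ = 2 := x-degree ≥ 2 members with |J_D| ≥ 2 or J_D = {j₀ ≥ 1} (M17P the standing witness) ∪ x-linear pairs outside XLinTM); PORT GO (K verbatim; docstrings/provenance only; «cite-token» spelling incl. «Mahler1933»; dedup 0) — census STAGING NOTE 6 L2667, crit ACK L2668 (staging sanctioned; identity-diff expectation identical 98 · MOD 3 · differ 0). Port by census-1 gen 22 as `RootDecomp1KThueMahler01–04` (`--supports stmt-Schanuel-33364`; no census credit): 01 = §1 COPRIMALITY (no common root, the two charts, the RESULTANT BOUND on common divisors of the binary forms) + §2 THE ODD PART (`|F|·‖F‖₂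 ≤ |d₀|`) + §3 THE ARCHIMEDEAN FLOOR + §4 the bounded dyadic points `DyadicPt A B M r`, the integers `F_A`, `F_B` and the `2`-adic side; 02 = §5 THE THEOREM **`finite_dyadicPts`** (Thue–Mahler on the line: finitely many bounded dyadic points), **`levelFinite_xLinear_sep3 : LevelFinite (xLinP A B)`** and **`thinFibreAt_xLinear_sep3 : ThinFibreAt m₀ (xLinP A B)` for EVERY `m₀`** (B separable over ℚ, `3 ≤ deg B`, `deg A ≤ deg B`, `A ⊥ B`), the class predicate **`XLinTM P`**, `levelFinite_of_xLinTM` + §6 the odd-part lever by name `odd_dvd_resultant_of_onLevel` (Mahler 1933); 03 = §7 the x-linear presentation toolkit (`linC`, `xdeg_xLinP`, …) and the TERRITORY certificates by tree names; 04 = §8 the members **`L17C = (Y+3) + x(Y³−17)`**, **`E17C = (Y³+3) + x(Y³−17)`** and the infinite family **`LD17 D = (Y+3) + x(Y^D − 17)`, `D ≥ 3`** (`thinFibreAt_LD17` hyp-free, every `m₀`; `¬ DecidedAt 2`, `¬ LocalAt 2`, `¬ GaussAt`, `¬ HeightDecidedAt 2`, not of norm shape, `3 ≤ thinThreshold`)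 + §9 ERRATUM OF RECORD `L17P_eq_normShapeCurve` / `normShapeHyp_L17P` / `thinFibreAt_L17P_all` (hyp-free by node 10; ×0) + §10 sharpness and costume arithmetic. PORT EDITS: THREE one-line helpers PRIVATISED (file-local copies where used in a later part) — K's `isCoprime_num_den` (public twin `Literature.…SparseDyadicRationals.isCoprime_num_den` outside the import closure; private copies already in LevelFinite03/04/08/09), `isCoprime_two_pow_of_odd'` and `norm_intCast_Cp_le_one` (head dry-run dedup.foreign: print like BirchSwinnertonDyer decls) —; 30 one-line docstrings on undocumented computation lemmas of §7–§9 (statements quoted); otherwise none (no dedup.landed twin, no set_option, no cite-token in a def docstring); provenance doc blocks + continuation headers = K's own open-lines; statements and proofs VERBATIM. Rung 0 — nothing here proves Schanuel, 33364, 33363, 31077 or ThinFibre 2; the class, the members and the family are HYPOTHESIS-FREE (the one external theorem used is the tree's proved `ridout_window_pow`).)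
-/

/-!
# RootDecomp1KThueMahler — lens 1, generation 56, NODE 16 «THUE–MAHLER ON THE LINE»
  (RULE K-R46 payable clause «an infinite class of AMENDED-FRONTIER pairs made unconditional»; CLAIM L2656)

HONEST SCOPE (line 1).  ONE theorem-package on the K-line's thin-fibre residual `ThinFibreAt m₀ P` (tree
`RootDecomp1KDegreeLadder.ThinFibreAt`) with NO binder, NO hypothesis `def … : Prop`, NO Literature fact assumed; the ONE
Literature THEOREM used is the tree's own Ridout window `RootDecomp1KXAll.ridout_window_pow` (proved; already the supplier of
node 4).  Rung 0: nothing here proves Schanuel, `stmt-Schanuel-33364`, `ThinFibre 2`, `PadicSubspace` or `HeightComparison`.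

THE THEOREM.  For `A, B ∈ ℤ[Y]` with `B` SEPARABLE over `ℚ`, `n := deg B ≥ 3`, `deg A ≤ n` and `A ⊥ B` in `ℚ[Y]`:
the rationals `r` of bounded height-window `|r| ≤ C` with `B(r) ≠ 0` and `A(r)/B(r) ∈ ℤ[1/2]` BOUNDED (`= −s/2^e`, `|s| ≤ M·2^e`)
form a FINITE set (`finite_dyadicPts`) — Siegel's theorem for the line `A(y) + x·B(y) = 0` over the bounded dyadic `x`, proved
here by THUE–MAHLER's reduction: (i) ARCHIMEDEAN FLOOR `|B(r)| ≥ c₀` (compactness + coprimality + `|x| ≤ M`); (ii) the integers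
`F_A = dⁿA(r)`, `F_B = dⁿB(r)` (tree `hform_num_den`) with `2^e·F_A + s·F_B = 0`; (iii) GLOBAL ODD-PART RIGIDITY: the odd part
`o` of `F_B` divides `F_A`, hence a fixed `d₀ ≠ 0` (TWO-CHART Bézout: node 10's `bezout_forms` on `(A, B)` padded to degree `n`
and on their degree-`n` REVERSALS), so `|F_B|·‖F_B‖₂ = o ≤ |d₀|`; (iv) `2`-adic closeness with the HEIGHT exponent:
`‖B(r)‖₂ ≤ K·d^{−n}`, `‖lc·(r − β)‖₂ ≤ K'·d^{−n}` for a root `β ∈ ℂ₂` (tree `nearest_root`); (v) Ridout window `(2n−1, 2)`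
(`2·2 < 2n−1 ⇔ n ≥ 3`).  CONSEQUENCES: `levelFinite_xLinear_sep3 : LevelFinite (xLinP A B)` and
`thinFibreAt_xLinear_sep3 : ThinFibreAt m₀ (xLinP A B)` for EVERY `m₀` — the binder `3 ≤ m₀` of node 4's
`thinFibreAt_xLinear_sep` REMOVED on this class, node 11's `thinFibreAt_xLinear_of_padicSubspace` made UNCONDITIONAL on it;
the class predicate `XLinTM P` (intrinsic; hypotheses in the TREE's ℚ-spellings); the odd-part LEVER by name
(`odd_dvd_resultant_of_onLevel`, cite-token «Mahler1933»); MEMBERS `L17C = (Y+3) + x(Y³−17)`, `E17C = (Y³+3) + x(Y³−17)` and the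
INFINITE FAMILY `LD17 D = (Y+3) + x(Y^D − 17)`, `D ≥ 3` (`thinFibreAt_LD17`, hyp-free, every `m₀`) with the TERRITORY certificates
by tree names (`¬ DecidedAt 2`, `¬ LocalAt 2` — irrational simple `ℚ₂`-root by Hensel, typed —, `¬ GaussAt 2`, `¬ HeightDecidedAt 2`,
not of norm shape, `3 ≤ thinThreshold`; uniform in odd `D`); the ERRATUM of record `L17P = normShapeCurve (−(Y+3)) (Y²−17) 1 1`
(so `ThinFibreAt m₀ L17P` hyp-free by node 10 — a correction ×0); SHARPNESS / costume arithmetic (§10).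
NOT reached: `deg B = 2` outside `NormShapeHyp` (Ridout exponent `3/2 < 2`), `deg A = deg B + 1`, Ridout-critical tops
(`n ≤ 2μ_β`), `x`-degree `≥ 2` (`p_N^j`, `j ≥ 1`, multiplies the non-top coefficients, so the odd part of `F_top` is no longer
bounded by a resultant: `M17P` is the standing witness); `ThinFibre 2`, 33364, 31077 do not move.
SOURCES (no problem-relative novelty claimed for the number theory, only for the K-line reach): K. Mahler, Math. Ann. 107 (1933)
691–730 (largest prime divisor of binary forms; Thue–Mahler); Evertse–Győry, Unit Equations in Diophantine Number Theory (2015);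
Bombieri–Gubler, Heights in Diophantine Geometry (2006); D. Ridout, Mathematika 4 (1957) 125–131.
-/

noncomputable section

namespace Summit.Schanuel.Schanuel.Theorems.RootDecomp1KThueMahler

open Polynomial LiouvilleNumber
open scoped Nat
open Summit.Schanuel.Schanuel.Theorems.RootDecomp1KTwoBaseCell (psNumer)
open Summit.Schanuel.Schanuel.Theorems.RootDecomp1KDegreeLadder
open Summit.Schanuel.Schanuel.Theorems.RootDecomp1KXLinear
open Summit.Schanuel.Schanuel.Theorems.RootDecomp1KXLinearII
open Summit.Schanuel.Schanuel.Theorems.RootDecomp1KXAll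
open Summit.Schanuel.Schanuel.Theorems.RootDecomp1KLevelFinite
open Summit.Schanuel.Schanuel.Theorems.RootDecomp1KSubspaceBranch
open Summit.Schanuel.Schanuel.Theorems.RootDecomp1KXTop
open Summit.Schanuel.Schanuel.Theorems.RootDecomp1KLocalExponent
open Summit.Schanuel.Schanuel.Theorems.RootDecomp1KIntegrality
open Summit.Schanuel.Schanuel.Theorems.RootDecomp1KHeightGrading
open Summit.Schanuel.Schanuel.Theorems.RootDecomp1KHeightMachine

/-! ## §1  COPRIMALITY: no common root, the two charts, the RESULTANT BOUND on common divisors of the binary forms -/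

/-- `A ⊥ B` in `ℚ[Y]` ⇒ no common root in any field of characteristic `0`. -/
theorem aeval_ne_zero_or_of_isCoprime {A B : ℤ[X]}
    (hcop : IsCoprime (A.map (Int.castRingHom ℚ)) (B.map (Int.castRingHom ℚ)))
    {F : Type*} [Field F] [Algebra ℚ F] (z : F) : aeval z A ≠ 0 ∨ aeval z B ≠ 0 := by
  obtain ⟨u, v, huv⟩ := hcop
  by_contra h
  simp only [not_or, not_not] at h
  have h1 := congrArg (aeval z) huv
  rw [map_add, map_mul, map_mul, ← algebraMap_int_eq, aeval_map_algebraMap, aeval_map_algebraMap, h.1, h.2,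
    mul_zero, mul_zero, add_zero, map_one] at h1
  exact zero_ne_one h1

/-- the straight chart: the padded truncations `cpoly A.coeff n`, `cpoly B.coeff n` are coprime in `ℚ[Y]`. -/
theorem isCoprime_cpoly_pad {A B : ℤ[X]} {n : ℕ} (hA : A.natDegree ≤ n) (hB : B.natDegree ≤ n)
    (hcop : IsCoprime (A.map (Int.castRingHom ℚ)) (B.map (Int.castRingHom ℚ))) :
    IsCoprime (cpoly A.coeff n) (cpoly B.coeff n) := by
  rwa [cpoly_coeff_eq_map A hA, cpoly_coeff_eq_map B hB]

/-- value of a reflected truncation at `0`: the top coefficient. -/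
theorem aeval_cpoly_reflect_zero {F : Type*} [Field F] [Algebra ℚ F] (c : ℕ → ℤ) (n : ℕ) :
    aeval (0 : F) (cpoly (fun i => c (n - i)) n) = (c n : F) := by
  rw [aeval_cpoly, Finset.sum_eq_single 0]
  · simp
  · intro i _ hi
    rw [zero_pow hi, mul_zero]
  · intro h; simp at h

/-- the reversed chart: the degree-`n` REVERSALS are coprime in `ℚ[Y]` too (`B.coeff n ≠ 0`: no common root at `0`). -/
theorem isCoprime_cpoly_rev {A B : ℤ[X]} {n : ℕ} (hA : A.natDegree ≤ n) (hB : B.natDegree ≤ n) (hBn : B.coeff n ≠ 0)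
    (hcop : IsCoprime (A.map (Int.castRingHom ℚ)) (B.map (Int.castRingHom ℚ))) :
    IsCoprime (cpoly (fun i => A.coeff (n - i)) n) (cpoly (fun i => B.coeff (n - i)) n) := by
  refine (Polynomial.isCoprime_iff_aeval_ne_zero_of_isAlgClosed (k := ℚ) (K := ℂ) _ _).mpr fun z => ?_
  by_cases hz0 : z = 0
  · right
    rw [hz0, aeval_cpoly_reflect_zero]
    exact_mod_cast hBn
  · rw [aeval_cpoly_reflect _ _ hz0, aeval_cpoly_reflect _ _ hz0, aeval_cpoly_coeff A hA, aeval_cpoly_coeff B hB]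
    rcases aeval_ne_zero_or_of_isCoprime hcop z⁻¹ with h | h
    · exact Or.inl (mul_ne_zero (pow_ne_zero _ hz0) h)
    · exact Or.inr (mul_ne_zero (pow_ne_zero _ hz0) h)

/-- **RESULTANT BOUND.**  For `A ⊥ B` (both of degree `≤ n`, `B.coeff n ≠ 0`) there is `d₀ ≠ 0` divisible by every common
divisor of the two binary forms `F_A(u,v) = Σ aᵢuⁱvⁿ⁻ⁱ`, `F_B(u,v)` at coprime `(u, v)` with `u, v ≠ 0` (two-chart Bézout). -/
theorem exists_resultant_bound (A B : ℤ[X]) {n : ℕ} (hA : A.natDegree ≤ n) (hB : B.natDegree ≤ n) (hBn : B.coeff n ≠ 0)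
    (hcop : IsCoprime (A.map (Int.castRingHom ℚ)) (B.map (Int.castRingHom ℚ))) :
    ∃ d₀ : ℤ, d₀ ≠ 0 ∧ ∀ u v : ℤ, u ≠ 0 → v ≠ 0 → IsCoprime u v →
      ∀ m : ℤ, m ∣ hform A.coeff n u v → m ∣ hform B.coeff n u v → m ∣ d₀ := by
  obtain ⟨d₁, K₁, C₁, hd₁, -, -, -, hF₁⟩ := bezout_forms _ _ _ _ (isCoprime_cpoly_pad hA hB hcop)
  obtain ⟨d₂, K₂, C₂, hd₂, -, -, -, hF₂⟩ := bezout_forms _ _ _ _ (isCoprime_cpoly_rev hA hB hBn hcop)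
  refine ⟨d₁ * d₂, mul_ne_zero hd₁ hd₂, fun u v hu hv huv m hmA hmB => ?_⟩
  obtain ⟨P, Q, hPQ, -, -⟩ := hF₁ u v hv
  obtain ⟨P', Q', hPQ', -, -⟩ := hF₂ v u hu
  rw [← hform_reflect A.coeff n u v, ← hform_reflect B.coeff n u v] at hPQ'
  have h1 : m ∣ d₁ * v ^ K₁ := by
    rw [← hPQ]; exact dvd_add (Dvd.dvd.mul_left hmA _) (Dvd.dvd.mul_left hmB _)
  have h2 : m ∣ d₂ * u ^ K₂ := by
    rw [← hPQ']; exact dvd_add (Dvd.dvd.mul_left hmA _) (Dvd.dvd.mul_left hmB _)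
  obtain ⟨x, y, hxy⟩ := (IsCoprime.pow huv : IsCoprime (u ^ K₂) (v ^ K₁))
  have : d₁ * d₂ = x * d₁ * (d₂ * u ^ K₂) + y * d₂ * (d₁ * v ^ K₁) := by
    linear_combination (-(d₁ : ℤ) * d₂) * hxy
  rw [this]
  exact dvd_add (Dvd.dvd.mul_left h2 _) (Dvd.dvd.mul_left h1 _)

/-! ## §2  THE ODD PART: `|F|·‖F‖₂ ≤ |d₀|` when the odd part of `F` divides `d₀` -/

/-- `‖z‖₂ ≤ 1` for an integer `z`, in `ℂ₂`. -/
private theorem norm_intCast_Cp_le_one (z : ℤ) : ‖(z : PadicAlgCl 2)‖ ≤ 1 := by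
  rw [← map_intCast (algebraMap ℚ_[2] (PadicAlgCl 2)) z, PadicAlgCl.norm_extends]
  exact Padic.norm_int_le_one z

/-- an odd integer is coprime to every power of `2`. -/
private theorem isCoprime_two_pow_of_odd' {o : ℤ} (ho : Odd o) (e : ℕ) : IsCoprime o ((2 : ℤ) ^ e) := by
  obtain ⟨j, hj⟩ := ho
  have h : IsCoprime o (2 : ℤ) := ⟨1, -j, by rw [hj]; ring⟩
  exact h.pow_right

/-- **PRODUCT FORMULA FOR THE ODD PART.**  If `2^e·G + s·F = 0` and every ODD common divisor of `G` and `F` divides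
`d₀ ≠ 0`, then `|F|·‖F‖₂ ≤ |d₀|` (the odd part `o` of `F` divides `F`, hence `s·F = −2^e G`, hence `G`; and
`|F|·‖F‖₂ = 2^v·o·2^{−v}·‖o‖₂ ≤ o`). -/
theorem abs_mul_norm_le_of_odd_part {F G s d₀ : ℤ} {e : ℕ} (hF : F ≠ 0) (hd₀ : d₀ ≠ 0)
    (hrel : (2 : ℤ) ^ e * G + s * F = 0)
    (hdiv : ∀ m : ℤ, Odd m → m ∣ G → m ∣ F → m ∣ d₀) :
    (|(F : ℝ)|) * ‖(F : PadicAlgCl 2)‖ ≤ |(d₀ : ℝ)| := by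
  obtain ⟨k, m, hm, hkm⟩ := Nat.exists_eq_two_pow_mul_odd (Int.natAbs_ne_zero.mpr hF)
  -- `|F| = 2^k * m` with `m` odd
  have habs : (|F| : ℤ) = 2 ^ k * (m : ℤ) := by
    rw [← Int.natCast_natAbs, hkm]; push_cast; ring
  have hmodd : Odd (m : ℤ) := by exact_mod_cast hm
  have hmF : (m : ℤ) ∣ F := by
    have h1 : (m : ℤ) ∣ |F| := ⟨2 ^ k, by rw [habs]; ring⟩
    exact h1.trans (abs_dvd_self F)
  have hmG : (m : ℤ) ∣ G := by
    have h1 : (m : ℤ) ∣ (2 : ℤ) ^ e * G := by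
      have : (2 : ℤ) ^ e * G = -(s * F) := by linear_combination hrel
      rw [this]; exact (Dvd.dvd.mul_left hmF _).neg_right
    exact (isCoprime_two_pow_of_odd' hmodd e).dvd_of_dvd_mul_left h1
  have hmd : (m : ℤ) ∣ d₀ := hdiv _ hmodd hmG hmF
  have hmle : (m : ℝ) ≤ |(d₀ : ℝ)| := by
    have h1 : (m : ℤ) ≤ |d₀| := Int.le_of_dvd (abs_pos.mpr hd₀) ((dvd_abs _ _).mpr hmd)
    have h2 : ((m : ℤ) : ℝ) ≤ ((|d₀| : ℤ) : ℝ) := by exact_mod_cast h1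
    rw [Int.cast_abs] at h2
    exact_mod_cast h2
  -- the 2-adic norm of `|F|`
  have hnormF : ‖(F : PadicAlgCl 2)‖ = ‖((|F| : ℤ) : PadicAlgCl 2)‖ := by
    rcases abs_choice F with h | h
    · rw [h]
    · rw [h, Int.cast_neg, norm_neg]
  have hnorm : ‖(F : PadicAlgCl 2)‖ ≤ (1 / 2 : ℝ) ^ k := by
    rw [hnormF, habs, Int.cast_mul, Int.cast_pow, norm_mul, norm_pow, Int.cast_ofNat, norm_two_Cp, Int.cast_natCast]
    calc (1 / 2 : ℝ) ^ k * ‖((m : ℕ) : PadicAlgCl 2)‖ ≤ (1 / 2 : ℝ) ^ k * 1 := by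
          gcongr
          have := norm_intCast_Cp_le_one (m : ℤ)
          rwa [Int.cast_natCast] at this
      _ = (1 / 2 : ℝ) ^ k := mul_one _
  have habsR : |(F : ℝ)| = 2 ^ k * (m : ℝ) := by
    have := congrArg (Int.cast : ℤ → ℝ) habs
    push_cast at this
    exact this
  calc |(F : ℝ)| * ‖(F : PadicAlgCl 2)‖ ≤ (2 ^ k * (m : ℝ)) * (1 / 2 : ℝ) ^ k := by
        rw [habsR]; gcongr
    _ = (m : ℝ) := by
        rw [mul_comm, ← mul_assoc, ← mul_pow]; norm_num
    _ ≤ |(d₀ : ℝ)| := hmle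

/-! ## §3  THE ARCHIMEDEAN FLOOR (compactness + coprimality) -/

/-- **ARCHIMEDEAN FLOOR.**  For `A ⊥ B` and a window `C`, a bound `M`: some `c₀ > 0` with `|B(t)| ≥ c₀` for every real
`|t| ≤ C` at which `|A(t)| ≤ M·|B(t)|` (no common real root; `|A| + |B|` has a positive minimum on `[−|C|, |C|]`). -/
theorem exists_arch_floor (A B : ℤ[X]) (hcop : IsCoprime (A.map (Int.castRingHom ℚ)) (B.map (Int.castRingHom ℚ)))
    (C M : ℝ) : ∃ c₀ : ℝ, 0 < c₀ ∧ ∀ t : ℝ, |t| ≤ C → |aeval t A| ≤ M * |aeval t B| → c₀ ≤ |aeval t B| := by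
  set f : ℝ → ℝ := fun t => |aeval t A| + |aeval t B| with hf
  have hfc : Continuous f :=
    (Polynomial.continuous_aeval (p := A)).abs.add (Polynomial.continuous_aeval (p := B)).abs
  have hne : (Set.Icc (-|C|) |C|).Nonempty := ⟨0, by simp [abs_nonneg]⟩
  obtain ⟨t₀, ht₀, hmin⟩ := isCompact_Icc.exists_isMinOn hne hfc.continuousOn
  have hpos : 0 < f t₀ := by
    rcases aeval_ne_zero_or_of_isCoprime hcop (F := ℝ) t₀ with h | h
    · exact lt_of_lt_of_le (abs_pos.mpr h) (le_add_of_nonneg_right (abs_nonneg _))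
    · exact lt_of_lt_of_le (abs_pos.mpr h) (le_add_of_nonneg_left (abs_nonneg _))
  refine ⟨f t₀ / (|M| + 1), div_pos hpos (by positivity), fun t ht hAB => ?_⟩
  have htI : t ∈ Set.Icc (-|C|) |C| := by
    have hC : C ≤ |C| := le_abs_self C
    constructor <;> [linarith [neg_abs_le t, abs_le.mp (ht.trans hC)]; exact (abs_le.mp (ht.trans hC)).2]
  have h1 : f t₀ ≤ f t := hmin htI
  have h2 : |aeval t A| ≤ |M| * |aeval t B| :=
    hAB.trans (mul_le_mul_of_nonneg_right (le_abs_self M) (abs_nonneg _))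
  have h3 : f t ≤ (|M| + 1) * |aeval t B| := by
    simp only [hf] at *
    nlinarith [abs_nonneg (aeval t B)]
  rw [div_le_iff₀ (by positivity)]
  nlinarith [abs_nonneg (aeval t B), abs_nonneg M]

/-! ## §4  BOUNDED DYADIC POINTS OF THE LINE `A(y) + x·B(y) = 0`: the integers `F_A`, `F_B` and the `2`-adic side -/

/-- **bounded dyadic point** of the line `A(y) + x·B(y) = 0`: `B(r) ≠ 0` and `x = −A(r)/B(r) = s / 2^e` with `|s| ≤ M·2^e`
(`x ∈ ℤ[1/2]`, `|x| ≤ M`); a level point `(s_N, r)` is one with `s = p_N`, `e = N!`, `M = 2` (`dyadicPt_of_onLevel`). -/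
def DyadicPt (A B : ℤ[X]) (M : ℝ) (r : ℚ) : Prop :=
  aeval r B ≠ 0 ∧ ∃ (s : ℤ) (e : ℕ), |(s : ℝ)| ≤ M * 2 ^ e ∧ (2 : ℚ) ^ e * aeval r A + s * aeval r B = 0

/-- the relation `2^e·F_A + s·F_B = 0` of a dyadic point, over `ℤ`. -/
theorem hform_rel {A B : ℤ[X]} {n : ℕ} (hA : A.natDegree ≤ n) (hB : B.natDegree ≤ n) {r : ℚ} {s : ℤ} {e : ℕ}
    (h : (2 : ℚ) ^ e * aeval r A + s * aeval r B = 0) :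
    (2 : ℤ) ^ e * hform A.coeff n r.num (r.den : ℤ) + s * hform B.coeff n r.num (r.den : ℤ) = 0 := by
  apply Int.cast_injective (α := ℚ)
  push_cast
  rw [hform_num_den A hA r, hform_num_den B hB r]
  calc (2 : ℚ) ^ e * ((r.den : ℚ) ^ n * aeval r A) + (s : ℚ) * ((r.den : ℚ) ^ n * aeval r B)
        = (r.den : ℚ) ^ n * ((2 : ℚ) ^ e * aeval r A + s * aeval r B) := by ring
    _ = 0 := by rw [h, mul_zero]

/-- `F_B ≠ 0` when `B(r) ≠ 0`. -/
theorem hform_ne_zero_of_aeval {B : ℤ[X]} {n : ℕ} (hB : B.natDegree ≤ n) {r : ℚ} (hBr : aeval r B ≠ 0) :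
    hform B.coeff n r.num (r.den : ℤ) ≠ 0 := by
  intro h
  have h1 := hform_num_den B hB r
  rw [h, Int.cast_zero] at h1
  have hd : (r.den : ℚ) ^ n ≠ 0 := pow_ne_zero _ (by exact_mod_cast r.den_nz)
  exact hBr (by
    rcases mul_eq_zero.mp h1.symm with h2 | h2
    · exact (hd h2).elim
    · exact h2)

/-- `|F_B| = den(r)ⁿ·|B(r)|` over `ℝ`. -/
theorem abs_hform_eq {B : ℤ[X]} {n : ℕ} (hB : B.natDegree ≤ n) (r : ℚ) :
    |((hform B.coeff n r.num (r.den : ℤ) : ℤ) : ℝ)| = (r.den : ℝ) ^ n * |aeval (r : ℝ) B| := by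
  have h1 := congrArg (Rat.cast : ℚ → ℝ) (hform_num_den B hB r)
  push_cast at h1
  rw [aeval_ratCast] at h1
  rw [h1, abs_mul, abs_of_nonneg (by positivity)]

/-- `F_B = den(r)ⁿ·B(r)` in `ℂ₂`. -/
theorem hform_cast_Cp {B : ℤ[X]} {n : ℕ} (hB : B.natDegree ≤ n) (r : ℚ) :
    ((hform B.coeff n r.num (r.den : ℤ) : ℤ) : PadicAlgCl 2) = (r.den : PadicAlgCl 2) ^ n * aeval (r : PadicAlgCl 2) B := by
  have h1 := congrArg (Rat.cast : ℚ → PadicAlgCl 2) (hform_num_den B hB r)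
  push_cast at h1
  rw [aeval_ratCast] at h1
  exact h1

/-- the archimedean inequality of a dyadic point: `|A(r)| ≤ M·|B(r)|`. -/
theorem abs_aeval_le_of_dyadicPt {A B : ℤ[X]} {M : ℝ} {r : ℚ} (h : DyadicPt A B M r) :
    |aeval (r : ℝ) A| ≤ M * |aeval (r : ℝ) B| := by
  obtain ⟨-, s, e, hs, hrel⟩ := h
  have h1 := congrArg (Rat.cast : ℚ → ℝ) hrel
  push_cast at h1
  rw [aeval_ratCast, aeval_ratCast] at h1
  have h2 : (0 : ℝ) < 2 ^ e := by positivity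
  have h3 : aeval (r : ℝ) A * 2 ^ e = -(s : ℝ) * aeval (r : ℝ) B := by linarith
  have h4 : |aeval (r : ℝ) A| * 2 ^ e ≤ M * |aeval (r : ℝ) B| * 2 ^ e := by
    calc |aeval (r : ℝ) A| * 2 ^ e = |aeval (r : ℝ) A * 2 ^ e| := by rw [abs_mul, abs_of_pos h2]
      _ = |(s : ℝ)| * |aeval (r : ℝ) B| := by rw [h3, abs_mul, abs_neg]
      _ ≤ (M * 2 ^ e) * |aeval (r : ℝ) B| := by gcongr
      _ = M * |aeval (r : ℝ) B| * 2 ^ e := by ring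
  exact le_of_mul_le_mul_right h4 h2

/-- `num r ⊥ den r` as integers. -/
private theorem isCoprime_num_den (r : ℚ) : IsCoprime r.num (r.den : ℤ) := by
  rw [Int.isCoprime_iff_gcd_eq_one]
  have := r.reduced
  simpa [Int.gcd] using this

/-- `‖k‖₂ < 1 ⇒ 2 ∣ k` for an integer `k`, read in `ℂ₂`. -/
theorem two_dvd_of_norm_lt_one {k : ℤ} (h : ‖(k : PadicAlgCl 2)‖ < 1) : (2 : ℤ) ∣ k := by
  rw [← map_intCast (algebraMap ℚ_[2] (PadicAlgCl 2)) k, PadicAlgCl.norm_extends] at h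
  exact_mod_cast (Padic.norm_intCast_lt_one_iff (p := 2)).mp h

/-- an odd integer has `‖k‖₂ = 1` in `ℂ₂`. -/
theorem norm_eq_one_of_not_two_dvd {k : ℤ} (h : ¬ (2 : ℤ) ∣ k) : ‖(k : PadicAlgCl 2)‖ = 1 := by
  refine le_antisymm (norm_intCast_Cp_le_one k) ?_
  by_contra hlt
  exact h (two_dvd_of_norm_lt_one (lt_of_not_ge hlt))

/-- if `2 ∣ den r` then `num r` is odd. -/
theorem not_two_dvd_num {r : ℚ} (h : (2 : ℤ) ∣ (r.den : ℤ)) : ¬ (2 : ℤ) ∣ r.num := by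
  intro hn
  have h1 : 2 ∣ r.num.natAbs := by
    have := Int.natAbs_dvd_natAbs.mpr hn
    simpa using this
  have h2 : 2 ∣ r.den := by exact_mod_cast h
  have h3 := Nat.dvd_gcd h1 h2
  rw [r.reduced] at h3
  exact absurd (Nat.le_of_dvd one_pos h3) (by norm_num)

/-- **HOMOGENISED ROOT PRODUCT**: `F_B(num, den) = lc_B · ∏_β (num − β·den)` in `ℂ₂` (from the tree's product formula). -/
theorem hform_eq_prod {B : ℤ[X]} {T : Finset (PadicAlgCl 2)} (hcard : T.card = B.natDegree)
    (hprod : ∀ z : PadicAlgCl 2, aeval z B = (B.leadingCoeff : PadicAlgCl 2) * ∏ β ∈ T, (z - β)) (r : ℚ) :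
    ((hform B.coeff B.natDegree r.num (r.den : ℤ) : ℤ) : PadicAlgCl 2) =
      (B.leadingCoeff : PadicAlgCl 2) * ∏ β ∈ T, ((r.num : PadicAlgCl 2) - β * (r.den : PadicAlgCl 2)) := by
  have hden : ((r.den : ℕ) : PadicAlgCl 2) ≠ 0 := by exact_mod_cast r.den_nz
  rw [hform_cast_Cp le_rfl r, hprod, ← hcard, ← Finset.prod_const, mul_left_comm, ← Finset.prod_mul_distrib]
  congr 1
  refine Finset.prod_congr rfl fun β _ => ?_
  rw [Rat.cast_def, mul_sub, mul_div_assoc', mul_div_cancel_left₀ _ hden]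
  ring

end Summit.Schanuel.Schanuel.Theorems.RootDecomp1KThueMahler

end
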